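import Literature.NumberTheory.EllipticCurves.WeilPairingLevelDescent
import Literature.NumberTheory.EllipticCurves.WeilPairingTateDual
import Literature.NumberTheory.EllipticCurves.SelmerLocalConditionCofinite
import Literature.NumberTheory.EllipticCurves.LocalKummerIsotropyTransport
import Literature.NumberTheory.GaloisCohomology.PairingTateDual
import HarnessLib

/-!
# The local terms of the first case of the Cassels–Tate pairing at level `m` with auxiliary level `m²`

Topic `NumberTheory/EllipticCurves`; namespace `Literature.NumberTheory.EllipticCurves`. Definitions
with bodies and theorems only: **no named fact is introduced** (D-0026); the local isotropy enters as
an explicit hypothesis `hiso` (isotropy of `𝓛_E^{(m²)}`; supplied by the named fact of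
`KummerImageIsotropy.lean` through `weilLocalCup_eq_zero_of_mem_of_fact`).

Milne's construction (*ADT* I, proof of Prop. 6.9, first case): for `a ∈ Ш(E/K)[m]` with a Selmer lift
`b ∈ H¹(K, E[m])` that lifts to `b₁ ∈ H¹(K, E[m²])` along `[m]`, local lifts `b_{v,1} ∈ H¹(K_v, E[m²])`
of `b_v` in the image of `E(K_v)`, and a Selmer lift `b'` of `a'` with local lifts `b'_{v,1}`, the
pairing is `∑_v inv_v(c_v ∪ b'_v)` with `ι c_v = b_{v,1} - b_{1,v}`. Since
`⟨ι c, b'_{v,1}⟩_{m²} = ⟨c, b'_v⟩` (`WeilPairingLevelDescent.lean`), the local term can be written at the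
single coefficient level `μ_{m²}` as `inv_v((loc_v b₁ - b_{v,1}) ∪_{m²} b'_{v,1})` (up to the sign).
This file defines that local term over an arbitrary `K`-field `E` (a completion `K_v`) and proves the
LOCAL parts of "independent of the choices":

* `cupProduct_restrict_weil_map_inclKD_eq_descend`, `…_eq_zero`: the restricted form over `E` of
  `ι_* x ∪_{m²} ỹ = x ∪_desc ([m]_* ỹ)`; `torsion_isSES_nat`, `exists_map_inclKD_eq_of_map_mulK_eq_zero`:
  local exactness of `H¹(E[m]) →ι H¹(E[m²]) →[m] H¹(E[m])` over `E`;
* `weilLocalCup W m E e …` (the restricted level-`m²` Weil cup product, bundled on the groups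
  `H¹(Γ_E, E[m²](K̄))`), `weilLocalCup_eq_zero_of_mem_of_fact` (isotropy of `𝓛_E` from the named fact);
* `ctLocalTerm W m E e … inv_E b₁ β β' = inv_E((res_E b₁ - β) ∪ β')`, additive
  (`ctLocalTerm_add_right/_add_left/_add_global`);
* `ctLocalTerm_eq_zero_of_mem`: **zero at the good places** (`res_E b₁, β, β' ∈ 𝓛_E`; isotropy);
* `ctLocalTerm_congr_mid`: **independent of `β = b_{v,1}` within `𝓛_E`** (isotropy);
* `ctLocalTerm_congr_right`: **independent of the lift `β' = b'_{v,1}` of `b'_v`** when `β` lifts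
  `res_E b₁` along `[m]` (local exactness and the descended pairing).

The global sum, its independence of `b₁, b, b'`, bilinearity and the vanishing on `mШ` are the sequel
(`CasselsTateFirstCase`). Motivation: provefact `WeierstrassCurve.exists_casselsTate_pairing`.

## References

* [MilneADT2006] J. S. Milne, *Arithmetic Duality Theorems*, 2nd ed. (2006), Ch. I §6, proof of
  Prop. 6.9 (pp. 78–79).
* [PoonenRains2012] B. Poonen, E. Rains, *Random maximal isotropic subspaces and Selmer groups*,
  J. Amer. Math. Soc. 25 (2012), Prop. 4.8, Cor. 4.6.
-/

noncomputable section

open scoped Classical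

universe u

namespace Literature.NumberTheory.EllipticCurves

open CategoryTheory _root_.WeierstrassCurve Field NumberField
open Literature.NumberTheory.GaloisRepresentations Literature.NumberTheory.GaloisCohomology
open Literature.NumberTheory.GaloisRepresentations.DiscreteGaloisModule (mu MuCarrier pairing)
open scoped ContRepresentation

-- Cup products need `LocallyCompactSpace Γ`; as in the tree's cup-product files, the compactness of
-- absolute Galois groups is a local instance only.
attribute [local instance] absoluteGaloisGroup_compactSpace

/-! ## Restricted level maps and the restricted cup-product identity (any `K`-field `E`) -/

section Restricted

variable {K : Type u} [Field K] [CharZero K] (W : WeierstrassCurve K) (m : ℕ) [NeZero m]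
variable (E : Type u) [Field E] [Algebra K E]
variable (e : geomTorsion W ((m * m : ℕ) : ℤ) → geomTorsion W ((m * m : ℕ) : ℤ) → AlgebraicClosure K)
  (hμ : ∀ S T, e S T ^ (m * m) = 1)
  (hadd₁ : ∀ S₁ S₂ T, e (S₁ + S₂) T = e S₁ T * e S₂ T)
  (hadd₂ : ∀ S T₁ T₂, e S (T₁ + T₂) = e S T₁ * e S T₂)
  (hgal : ∀ (σ : absoluteGaloisGroup K) (S T : geomTorsion W ((m * m : ℕ) : ℤ)),
    σ • e S T = e (σ • S) (σ • T))

/-- **The restricted cup-product identity** `ι_* x ∪_{m²} ỹ = x ∪_desc ([m]_* ỹ)` over a `K`-field `E`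
(restrictions of `weilContPairing W (m²) e` and `descendPairing` to `Γ_E`, level maps restricted to
`Γ_E`): one application of the tree's `ContPairing.cupProduct_adjoint` with
`w(ι x, ỹ) = descendHom x ([m] ỹ)`. [folklore] -/
theorem cupProduct_restrict_weil_map_inclKD_eq_descend
    (x : galoisCohomology (GaloisRep.restrictField E (W.torsionGaloisModule (m : ℤ))) 1)
    (y : galoisCohomology (GaloisRep.restrictField E (W.torsionGaloisModule ((m * m : ℕ) : ℤ))) 1) :
    ((weilContPairing W (m * m) e hμ hadd₁ hadd₂ hgal).restrict (absGaloisRestrict K E)).cupProduct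
        (galoisCohomology.map ((inclKD W m m).restrictField E) 1 x) y =
      ((descendPairing W m m e hμ hadd₁ hadd₂ hgal).restrict (absGaloisRestrict K E)).cupProduct x
        (galoisCohomology.map ((mulK W m m).restrictField E) 1 y) :=
  ContPairing.cupProduct_adjoint
    ((descendPairing W m m e hμ hadd₁ hadd₂ hgal).restrict (absGaloisRestrict K E))
    ((weilContPairing W (m * m) e hμ hadd₁ hadd₂ hgal).restrict (absGaloisRestrict K E))
    (DiscreteGaloisModule.homOfIntertwining ((inclKD W m m).restrictField E))
    (DiscreteGaloisModule.homOfIntertwining ((mulK W m m).restrictField E))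
    (fun S T => (descendHom_apply_eq W m m e hμ hadd₁ hadd₂ S (mulK W m m T) T rfl).symm) x y

/-- Hence **`ι_* x ∪_{m²} ỹ = 0` over `E` whenever `[m]_* ỹ = 0`**. [folklore] -/
theorem cupProduct_restrict_weil_map_inclKD_eq_zero
    (x : galoisCohomology (GaloisRep.restrictField E (W.torsionGaloisModule (m : ℤ))) 1)
    {y : galoisCohomology (GaloisRep.restrictField E (W.torsionGaloisModule ((m * m : ℕ) : ℤ))) 1}
    (hy : galoisCohomology.map ((mulK W m m).restrictField E) 1 y = 0) :
    ((weilContPairing W (m * m) e hμ hadd₁ hadd₂ hgal).restrict (absGaloisRestrict K E)).cupProduct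
        (galoisCohomology.map ((inclKD W m m).restrictField E) 1 x) y = 0 := by
  rw [cupProduct_restrict_weil_map_inclKD_eq_descend, hy]
  exact map_zero _

/-- The finite Kummer sequence `0 → E[m] →ι E[m²] →[m] E[m] → 0` at the level `((m * m : ℕ) : ℤ)`
(the tree's `torsion_isSES`, whose top level is typed `(m : ℤ) * (m : ℤ)`; the two agree
definitionally). [folklore] -/
theorem torsion_isSES_nat :
    IsSES (DiscreteGaloisModule.homOfIntertwining (inclKD W m m))
      (DiscreteGaloisModule.homOfIntertwining (mulK W m m)) :=
  W.torsion_isSES (Int.natCast_ne_zero.mpr (NeZero.ne m)) (m : ℤ)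

/-- **Local exactness of `H¹(E, E[m]) →ι H¹(E, E[m²]) →[m] H¹(E, E[m])`**: a class of
`H¹(Γ_E, E[m²](K̄))` killed by `[m]_*` comes from `H¹(Γ_E, E[m](K̄))` (the finite Kummer sequence
restricted to `Γ_E`, tree `torsion_isSES`, `IsSES.restrictField`,
`IsSES.exists_map_one_eq_of_map_one_eq_zero`). [folklore] -/
theorem exists_map_inclKD_eq_of_map_mulK_eq_zero
    {y : galoisCohomology (GaloisRep.restrictField E (W.torsionGaloisModule ((m * m : ℕ) : ℤ))) 1}
    (hy : galoisCohomology.map ((mulK W m m).restrictField E) 1 y = 0) :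
    ∃ x : galoisCohomology (GaloisRep.restrictField E (W.torsionGaloisModule (m : ℤ))) 1,
      galoisCohomology.map ((inclKD W m m).restrictField E) 1 x = y :=
  ((torsion_isSES_nat W m).restrictField E).exists_map_one_eq_of_map_one_eq_zero y hy

end Restricted

/-! ## The local term over a `K`-field `E` (a completion `K_v`) -/

section Local

variable {K : Type u} [Field K] [CharZero K] (W : WeierstrassCurve K) (m : ℕ) [NeZero m]
variable (E : Type u) [Field E] [Algebra K E]
variable (e : geomTorsion W ((m * m : ℕ) : ℤ) → geomTorsion W ((m * m : ℕ) : ℤ) → AlgebraicClosure K)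
  (hμ : ∀ S T, e S T ^ (m * m) = 1)
  (hadd₁ : ∀ S₁ S₂ T, e (S₁ + S₂) T = e S₁ T * e S₂ T)
  (hadd₂ : ∀ S T₁ T₂, e S (T₁ + T₂) = e S T₁ * e S T₂)
  (hgal : ∀ (σ : absoluteGaloisGroup K) (S T : geomTorsion W ((m * m : ℕ) : ℤ)),
    σ • e S T = e (σ • S) (σ • T))

/-- **The local Weil cup product over `E` at level `m²`** as a bi-additive map on the groups
`H¹(Γ_E, E[m²](K̄))` (the tree's `ContPairing.cupProduct` of the restriction of
`weilContPairing W (m²) e` to `Γ_E`, re-bundled on the `galoisCohomology` groups like the tree's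
`localTatePairing`; at a place `v`, `E = K_v`, this is the cup product of `weilContPairingLocal`).
[folklore] -/
def weilLocalCup :
    galoisCohomology (GaloisRep.restrictField E (W.torsionGaloisModule ((m * m : ℕ) : ℤ))) 1 →+
      galoisCohomology (GaloisRep.restrictField E (W.torsionGaloisModule ((m * m : ℕ) : ℤ))) 1 →+
        galoisCohomology (GaloisRep.restrictField E (mu K (m * m))) 2 where
  toFun x := (((weilContPairing W (m * m) e hμ hadd₁ hadd₂ hgal).restrict
    (absGaloisRestrict K E)).cupProduct x).toAddMonoidHom
  map_zero' := AddMonoidHom.ext fun y => DFunLike.congr_fun (map_zero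
    ((weilContPairing W (m * m) e hμ hadd₁ hadd₂ hgal).restrict (absGaloisRestrict K E)).cupProduct) y
  map_add' x x' := AddMonoidHom.ext fun y => DFunLike.congr_fun (map_add
    ((weilContPairing W (m * m) e hμ hadd₁ hadd₂ hgal).restrict (absGaloisRestrict K E)).cupProduct x x') y

omit [CharZero K] in
/-- Unfolding `weilLocalCup`. [folklore] -/
theorem weilLocalCup_apply
    (x y : galoisCohomology (GaloisRep.restrictField E (W.torsionGaloisModule ((m * m : ℕ) : ℤ))) 1) :
    weilLocalCup W m E e hμ hadd₁ hadd₂ hgal x y =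
      ((weilContPairing W (m * m) e hμ hadd₁ hadd₂ hgal).restrict (absGaloisRestrict K E)).cupProduct x y :=
  rfl

/-- **Isotropy of the local Kummer condition over `E` at level `m²` from the named isotropy fact**
over `E` (for `e` alternating): the local Weil cup product vanishes on `𝓛_E^{(m²)} × 𝓛_E^{(m²)}` —
the hypothesis `hiso` of the lemmas below (tree `cupProduct_eq_zero_of_mem_kummerLocalConditionAt_of_fact`,
file `LocalKummerIsotropyTransport`). [cite: PoonenRains2012, Prop. 4.8 and Cor. 4.6] -/
theorem weilLocalCup_eq_zero_of_mem_of_fact [W.IsElliptic] [CharZero E]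
    (hiso : kummerClass_cupProduct_kummerClass_eq_zero E) (halt : ∀ T, e T T = 1)
    ⦃x y : galoisCohomology (GaloisRep.restrictField E (W.torsionGaloisModule ((m * m : ℕ) : ℤ))) 1⦄
    (hx : x ∈ W.kummerLocalConditionAt ((m * m : ℕ) : ℤ) E)
    (hy : y ∈ W.kummerLocalConditionAt ((m * m : ℕ) : ℤ) E) :
    weilLocalCup W m E e hμ hadd₁ hadd₂ hgal x y = 0 :=
  W.cupProduct_eq_zero_of_mem_kummerLocalConditionAt_of_fact (m * m) e
    (Int.natCast_ne_zero.mpr (NeZero.ne (m * m))) hiso hμ hadd₁ hadd₂ halt hgal hx hy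

variable (invE : galoisCohomology (GaloisRep.restrictField E (mu K (m * m))) 2 →+ ZMod (m * m))

/-- **The local term over `E`** of the first case of the Cassels–Tate pairing at level `m`
(auxiliary level `m²`): for a global `b₁ ∈ H¹(K, E[m²])`, local classes `β, β' ∈ H¹(Γ_E, E[m²])`
and a local "invariant" `inv_E : H²(Γ_E, μ_{m²}) → ℤ/m²`,

  `t_E(b₁; β, β') = inv_E ((res_E b₁ - β) ∪_{m²} β')  ∈ ℤ/m²`.

In Milne's notation (*ADT* I, proof of Prop. 6.9; `E = K_v`) `β = b_{v,1}` is a lift of `b_v` to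
`H¹(K_v, A_{m²})` in the image of `A(K_v)`, `res_v b₁ - β = b_{1,v} - b_{v,1}` is (minus) the image
of `c_v ∈ H¹(K_v, A_m)`, and `β' = b'_{v,1}` a local lift of `b'_v`; as
`⟨ι c, b'_{v,1}⟩_{m²} = ⟨c, m b'_{v,1}⟩ = ⟨c, b'_v⟩`, this is `-inv_v(c_v ∪ b'_v)`, Milne's local term
up to the global sign, written entirely at the coefficient level `μ_{m²}`.
[cite: MilneADT2006, Ch. I §6, proof of Prop. 6.9] -/
def ctLocalTerm (b₁ : galoisCohomology (W.torsionGaloisModule ((m * m : ℕ) : ℤ)) 1)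
    (β β' : galoisCohomology (GaloisRep.restrictField E (W.torsionGaloisModule ((m * m : ℕ) : ℤ))) 1) :
    ZMod (m * m) :=
  invE (weilLocalCup W m E e hμ hadd₁ hadd₂ hgal
    (galoisCohomology.res (W.torsionGaloisModule ((m * m : ℕ) : ℤ)) E 1 b₁ - β) β')

omit [CharZero K] in
/-- `t_E` is additive in `β'`. [folklore] -/
theorem ctLocalTerm_add_right (b₁ : galoisCohomology (W.torsionGaloisModule ((m * m : ℕ) : ℤ)) 1)
    (β β' β'' : galoisCohomology (GaloisRep.restrictField E (W.torsionGaloisModule ((m * m : ℕ) : ℤ))) 1) :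
    ctLocalTerm W m E e hμ hadd₁ hadd₂ hgal invE b₁ β (β' + β'') =
      ctLocalTerm W m E e hμ hadd₁ hadd₂ hgal invE b₁ β β' +
        ctLocalTerm W m E e hμ hadd₁ hadd₂ hgal invE b₁ β β'' := by
  simp only [ctLocalTerm, map_add]

omit [CharZero K] in
/-- `t_E` is additive in the pair `(b₁, β)`. [folklore] -/
theorem ctLocalTerm_add_left (b₁ b₂ : galoisCohomology (W.torsionGaloisModule ((m * m : ℕ) : ℤ)) 1)
    (β β₂ β' : galoisCohomology (GaloisRep.restrictField E (W.torsionGaloisModule ((m * m : ℕ) : ℤ))) 1) :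
    ctLocalTerm W m E e hμ hadd₁ hadd₂ hgal invE (b₁ + b₂) (β + β₂) β' =
      ctLocalTerm W m E e hμ hadd₁ hadd₂ hgal invE b₁ β β' +
        ctLocalTerm W m E e hμ hadd₁ hadd₂ hgal invE b₂ β₂ β' := by
  simp only [ctLocalTerm]
  rw [← map_add invE, ← AddMonoidHom.add_apply, ← map_add (weilLocalCup W m E e hμ hadd₁ hadd₂ hgal),
    map_add (galoisCohomology.res _ E 1)]
  congr 2
  abel

omit [CharZero K] in
/-- Changing the global class with the local lift fixed:
`t_E(b₁ + b₂; β, β') = t_E(b₁; β, β') + inv_E(res_E b₂ ∪ β')`. [folklore] -/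
theorem ctLocalTerm_add_global (b₁ b₂ : galoisCohomology (W.torsionGaloisModule ((m * m : ℕ) : ℤ)) 1)
    (β β' : galoisCohomology (GaloisRep.restrictField E (W.torsionGaloisModule ((m * m : ℕ) : ℤ))) 1) :
    ctLocalTerm W m E e hμ hadd₁ hadd₂ hgal invE (b₁ + b₂) β β' =
      ctLocalTerm W m E e hμ hadd₁ hadd₂ hgal invE b₁ β β' +
        invE (weilLocalCup W m E e hμ hadd₁ hadd₂ hgal
          (galoisCohomology.res (W.torsionGaloisModule ((m * m : ℕ) : ℤ)) E 1 b₂) β') := by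
  have h := ctLocalTerm_add_left W m E e hμ hadd₁ hadd₂ hgal invE b₁ b₂ β 0 β'
  rw [add_zero] at h
  rw [h]
  congr 1
  simp only [ctLocalTerm, sub_zero]

variable {W m E e hμ hadd₁ hadd₂ hgal}

omit [CharZero K] in
/-- **`t_E = 0` at the good places**: if `res_E b₁`, `β` and `β'` all lie in the local Kummer
condition `𝓛_E^{(m²)}`, the local term vanishes (isotropy). At the places of a number field this holds
for all but finitely many `v` (`eventually_localization_mem_kummerSelmerStructure`).
[cite: MilneADT2006, Ch. I §6, proof of Prop. 6.9] -/
theorem ctLocalTerm_eq_zero_of_mem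
    (hiso : ∀ ⦃x y : galoisCohomology (GaloisRep.restrictField E (W.torsionGaloisModule ((m * m : ℕ) : ℤ))) 1⦄,
      x ∈ W.kummerLocalConditionAt ((m * m : ℕ) : ℤ) E → y ∈ W.kummerLocalConditionAt ((m * m : ℕ) : ℤ) E →
        weilLocalCup W m E e hμ hadd₁ hadd₂ hgal x y = 0)
    {b₁ : galoisCohomology (W.torsionGaloisModule ((m * m : ℕ) : ℤ)) 1}
    (hb₁ : galoisCohomology.res (W.torsionGaloisModule ((m * m : ℕ) : ℤ)) E 1 b₁ ∈
      W.kummerLocalConditionAt ((m * m : ℕ) : ℤ) E)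
    {β β' : galoisCohomology (GaloisRep.restrictField E (W.torsionGaloisModule ((m * m : ℕ) : ℤ))) 1}
    (hβ : β ∈ W.kummerLocalConditionAt ((m * m : ℕ) : ℤ) E)
    (hβ' : β' ∈ W.kummerLocalConditionAt ((m * m : ℕ) : ℤ) E) :
    ctLocalTerm W m E e hμ hadd₁ hadd₂ hgal invE b₁ β β' = 0 := by
  rw [ctLocalTerm, hiso (sub_mem hb₁ hβ) hβ', map_zero]

omit [CharZero K] in
/-- **Independence of the local lift `β = b_{v,1}`**: any two `β, β₂ ∈ 𝓛_E^{(m²)}` give the same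
local term when `β' ∈ 𝓛_E^{(m²)}` (the difference is `inv_E((β₂ - β) ∪ β') = 0` by isotropy).
[cite: MilneADT2006, Ch. I §6, proof of Prop. 6.9] -/
theorem ctLocalTerm_congr_mid
    (hiso : ∀ ⦃x y : galoisCohomology (GaloisRep.restrictField E (W.torsionGaloisModule ((m * m : ℕ) : ℤ))) 1⦄,
      x ∈ W.kummerLocalConditionAt ((m * m : ℕ) : ℤ) E → y ∈ W.kummerLocalConditionAt ((m * m : ℕ) : ℤ) E →
        weilLocalCup W m E e hμ hadd₁ hadd₂ hgal x y = 0)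
    (b₁ : galoisCohomology (W.torsionGaloisModule ((m * m : ℕ) : ℤ)) 1)
    {β β₂ β' : galoisCohomology (GaloisRep.restrictField E (W.torsionGaloisModule ((m * m : ℕ) : ℤ))) 1}
    (hβ : β ∈ W.kummerLocalConditionAt ((m * m : ℕ) : ℤ) E)
    (hβ₂ : β₂ ∈ W.kummerLocalConditionAt ((m * m : ℕ) : ℤ) E)
    (hβ' : β' ∈ W.kummerLocalConditionAt ((m * m : ℕ) : ℤ) E) :
    ctLocalTerm W m E e hμ hadd₁ hadd₂ hgal invE b₁ β β' =
      ctLocalTerm W m E e hμ hadd₁ hadd₂ hgal invE b₁ β₂ β' := by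
  rw [← sub_eq_zero, ctLocalTerm, ctLocalTerm, ← map_sub, ← AddMonoidHom.sub_apply, ← map_sub,
    show galoisCohomology.res (W.torsionGaloisModule ((m * m : ℕ) : ℤ)) E 1 b₁ - β -
      (galoisCohomology.res (W.torsionGaloisModule ((m * m : ℕ) : ℤ)) E 1 b₁ - β₂) = β₂ - β by abel,
    hiso (sub_mem hβ₂ hβ) hβ', map_zero]

/-- **Independence of the local lift `β' = b'_{v,1}`**: if `β` lifts `res_E b₁` along `[m]`
(`[m]_* β = [m]_* res_E b₁`, so that `res_E b₁ - β = ι_* c` comes from `H¹(Γ_E, E[m](K̄))`), then two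
`β', β₂'` with the same image under `[m]_*` give the same local term
(`ι_* c ∪_{m²} (β' - β₂') = c ∪_desc [m]_*(β' - β₂') = 0`). [cite: MilneADT2006, Ch. I §6, proof of Prop. 6.9] -/
theorem ctLocalTerm_congr_right (b₁ : galoisCohomology (W.torsionGaloisModule ((m * m : ℕ) : ℤ)) 1)
    {β β' β₂' : galoisCohomology (GaloisRep.restrictField E (W.torsionGaloisModule ((m * m : ℕ) : ℤ))) 1}
    (hβ : galoisCohomology.map ((mulK W m m).restrictField E) 1 β =
      galoisCohomology.map ((mulK W m m).restrictField E) 1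
        (galoisCohomology.res (W.torsionGaloisModule ((m * m : ℕ) : ℤ)) E 1 b₁))
    (hβ' : galoisCohomology.map ((mulK W m m).restrictField E) 1 β' =
      galoisCohomology.map ((mulK W m m).restrictField E) 1 β₂') :
    ctLocalTerm W m E e hμ hadd₁ hadd₂ hgal invE b₁ β β' =
      ctLocalTerm W m E e hμ hadd₁ hadd₂ hgal invE b₁ β β₂' := by
  rw [← sub_eq_zero, ctLocalTerm, ctLocalTerm, ← map_sub, ← map_sub]
  obtain ⟨c, hc⟩ := exists_map_inclKD_eq_of_map_mulK_eq_zero W m E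
    (y := galoisCohomology.res (W.torsionGaloisModule ((m * m : ℕ) : ℤ)) E 1 b₁ - β)
    (by rw [map_sub, hβ, sub_self])
  rw [weilLocalCup_apply, ← hc, cupProduct_restrict_weil_map_inclKD_eq_zero W m E e
    hμ hadd₁ hadd₂ hgal c (by rw [map_sub, hβ', sub_self])]
  exact map_zero _

end Local

end Literature.NumberTheory.EllipticCurves
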